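import Mathlib
import HarnessLib

/-!
# S2β · `hFlat` road, brick (ii-b)₄ of UV3-NODE §57.8 (D) — SLOT DOUBLE COUNTING: from per-bond slot sums to one ℓ² sum over plaquettes

Cell `ym3-torus` (rung R3 = continuum `SU(2)` Yang–Mills on the three-torus — NOT d = 4, NOT infinite volume, NOT a mass gap, NOT Clay).
Width seat «width 13» `ym3-torus-px13` (gen 22), FREE px helper on crux `stmt-QuantumFields-20520`, count-neutral, DEFINITION-FREE, `import Mathlib` + HarnessLib only.

WHY (UV3-NODE §57.8 (B) (R2); what ✓p815833∕✓p815925 (ii-b)₁,₂ leave for the (iv)-plumbing).  The relative letters bound, bond by bond,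
`dist1(rel b) ≤ Σ_{σ ∈ S_b} (a_W(f_b σ) + a_0(f_b σ))` over a configuration-independent family of plaquette SLOTS `f_b : S_b → plaquettes` with `#S_b ≤ K(L)`
and local base sites.  The recursion's error is the ℓ² norm `R_t² = Σ_b dist1(rel b)²`; turning it into `C(L)·Σ_p a(p)²` is DOUBLE COUNTING with a bounded
fibre multiplicity `M(L)` («how many (bond, slot) pairs point at a given plaquette»).  This file is the generic, geometry-free half of that count; the torus
half (the value of `M(L)` from the locality clauses `|w_ι| ≤ (L−1)∕2`, `0 ≤ w_μ < L`) is separate.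

* `sum_sum_comp_le_mul_sum` — `Σ_{b∈B} Σ_{σ∈S b} g(f b σ) ≤ M·Σ_{p∈T} g p` for `g ≥ 0`, fibres `#{(b,σ) : f b σ = p} ≤ M`, values in `T` (`Finset.sum_comp`);
* ★ `sum_sq_sum_comp_le` — `Σ_{b∈B} (Σ_{σ∈S b} a(f b σ))² ≤ K·M·Σ_{p∈T} a(p)²` (`#S b ≤ K`; Cauchy–Schwarz per bond, then double counting);
* ★ `sum_sq_sum_add_comp_le` — the two-field form `Σ_b (Σ_σ (a(f b σ) + a′(f b σ)))² ≤ 2·K·M·(Σ_T a² + Σ_T a′²)` (relative letters carry `W` and `U₀` terms);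
* `sqrt_sum_sq_sum_comp_le` — the same in ℓ²-norm form `‖Σ_σ a∘f‖_{ℓ²(B)} ≤ √(K·M)·‖a‖_{ℓ²(T)}`.

HONEST SCOPE.  Finite-sum algebra; the multiplicity `M(L)` of the actual slot families on the torus is NOT computed here; nothing of Bałaban's analysis; `hFlat`,
TUBE-REG∘, GAP♯∘, S2β, crux 20520, `YM3TorusSU2` NOT proved; no registered stub closed; the Yang–Mills mass gap is NOT proved.
References: T. Bałaban, CMP **99** (1985) 75–102 [Balaban1985RegularSpaces] ((1.29) p.81, the ℓ²-type regularity norms); CMP **98** (1985) 17–51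
[Balaban1985Averaging] ((19)–(20) p.21).
-/

set_option autoImplicit false

namespace Summit.QuantumFields.YangMills.Theorems.FluctuationComparisonRegPrIntLS2BetaSlotDoubleCounting

open Finset

variable {ι σ π : Type*}

/-- **DOUBLE COUNTING WITH BOUNDED FIBRES**: for `g ≥ 0`, if every plaquette `p` is hit by at most `M` (bond, slot) pairs and all values lie in `T`, then
`Σ_{b∈B} Σ_{σ∈S b} g(f b σ) ≤ M·Σ_{p∈T} g p`. [folklore] -/
theorem sum_sum_comp_le_mul_sum [DecidableEq π] (B : Finset ι) (S : ι → Finset σ) (f : ι → σ → π) (g : π → ℝ) (hg : ∀ p, 0 ≤ g p)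
    {M : ℕ} (hM : ∀ p, #{x ∈ B.sigma fun b => S b | f x.1 x.2 = p} ≤ M) {T : Finset π} (hT : ∀ b ∈ B, ∀ s ∈ S b, f b s ∈ T) :
    ∑ b ∈ B, ∑ s ∈ S b, g (f b s) ≤ M * ∑ p ∈ T, g p := by
  rw [sum_sigma' B (fun b => S b) (fun b s => g (f b s)),
    sum_comp g (fun x : (Σ _ : ι, σ) => f x.1 x.2)]
  have himg : ((B.sigma fun b => S b).image fun x : (Σ _ : ι, σ) => f x.1 x.2) ⊆ T := by
    intro p hp
    obtain ⟨x, hx, rfl⟩ := mem_image.mp hp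
    exact hT x.1 (mem_sigma.mp hx).1 x.2 (mem_sigma.mp hx).2
  calc ∑ p ∈ (B.sigma fun b => S b).image (fun x : (Σ _ : ι, σ) => f x.1 x.2),
        #{x ∈ B.sigma fun b => S b | f x.1 x.2 = p} • g p
      ≤ ∑ p ∈ (B.sigma fun b => S b).image (fun x : (Σ _ : ι, σ) => f x.1 x.2), (M : ℝ) * g p :=
        sum_le_sum fun p _ => by
          rw [nsmul_eq_mul]
          exact mul_le_mul_of_nonneg_right (by exact_mod_cast hM p) (hg p)
    _ ≤ ∑ p ∈ T, (M : ℝ) * g p :=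
        sum_le_sum_of_subset_of_nonneg himg fun p _ _ => mul_nonneg (Nat.cast_nonneg _) (hg p)
    _ = M * ∑ p ∈ T, g p := by rw [mul_sum]

/-- ★ **PER-BOND CAUCHY–SCHWARZ, THEN DOUBLE COUNTING**: `#S b ≤ K`, fibres `≤ M`, values in `T` ⟹
`Σ_{b∈B} (Σ_{σ∈S b} a(f b σ))² ≤ K·M·Σ_{p∈T} a(p)²` — the ℓ² size of a family of slot sums is at most `K·M` times the ℓ² size of the plaquette data.
[cite: Balaban1985RegularSpaces, (1.29) p.81] -/
theorem sum_sq_sum_comp_le [DecidableEq π] (B : Finset ι) (S : ι → Finset σ) (f : ι → σ → π) (a : π → ℝ)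
    {K : ℕ} (hK : ∀ b ∈ B, #(S b) ≤ K) {M : ℕ} (hM : ∀ p, #{x ∈ B.sigma fun b => S b | f x.1 x.2 = p} ≤ M)
    {T : Finset π} (hT : ∀ b ∈ B, ∀ s ∈ S b, f b s ∈ T) :
    ∑ b ∈ B, (∑ s ∈ S b, a (f b s)) ^ 2 ≤ K * M * ∑ p ∈ T, a p ^ 2 := by
  calc ∑ b ∈ B, (∑ s ∈ S b, a (f b s)) ^ 2
      ≤ ∑ b ∈ B, (K : ℝ) * ∑ s ∈ S b, a (f b s) ^ 2 := sum_le_sum fun b hb =>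
        (sq_sum_le_card_mul_sum_sq (s := S b) (f := fun s => a (f b s))).trans
          (mul_le_mul_of_nonneg_right (by exact_mod_cast hK b hb) (sum_nonneg fun s _ => sq_nonneg _))
    _ = K * ∑ b ∈ B, ∑ s ∈ S b, a (f b s) ^ 2 := by rw [mul_sum]
    _ ≤ K * (M * ∑ p ∈ T, a p ^ 2) := mul_le_mul_of_nonneg_left
        (sum_sum_comp_le_mul_sum B S f (fun p => a p ^ 2) (fun p => sq_nonneg _) hM hT) (Nat.cast_nonneg _)
    _ = K * M * ∑ p ∈ T, a p ^ 2 := by ring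

/-- ★ **TWO-FIELD FORM** (the relative letters carry a `W`-term and a `U₀`-term per slot): `Σ_b (Σ_σ (a + a′)∘f)² ≤ 2·K·M·(Σ_T a² + Σ_T a′²)`.
[cite: Balaban1985RegularSpaces, (1.29) p.81] -/
theorem sum_sq_sum_add_comp_le [DecidableEq π] (B : Finset ι) (S : ι → Finset σ) (f : ι → σ → π) (a a' : π → ℝ)
    {K : ℕ} (hK : ∀ b ∈ B, #(S b) ≤ K) {M : ℕ} (hM : ∀ p, #{x ∈ B.sigma fun b => S b | f x.1 x.2 = p} ≤ M)
    {T : Finset π} (hT : ∀ b ∈ B, ∀ s ∈ S b, f b s ∈ T) :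
    ∑ b ∈ B, (∑ s ∈ S b, (a (f b s) + a' (f b s))) ^ 2 ≤ 2 * K * M * (∑ p ∈ T, a p ^ 2 + ∑ p ∈ T, a' p ^ 2) := by
  have h1 := sum_sq_sum_comp_le B S f a hK hM hT
  have h2 := sum_sq_sum_comp_le B S f a' hK hM hT
  calc ∑ b ∈ B, (∑ s ∈ S b, (a (f b s) + a' (f b s))) ^ 2
      ≤ ∑ b ∈ B, (2 * (∑ s ∈ S b, a (f b s)) ^ 2 + 2 * (∑ s ∈ S b, a' (f b s)) ^ 2) := sum_le_sum fun b _ => by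
        rw [sum_add_distrib]
        nlinarith [sq_nonneg (∑ s ∈ S b, a (f b s) - ∑ s ∈ S b, a' (f b s))]
    _ = 2 * ∑ b ∈ B, (∑ s ∈ S b, a (f b s)) ^ 2 + 2 * ∑ b ∈ B, (∑ s ∈ S b, a' (f b s)) ^ 2 := by
        rw [sum_add_distrib, mul_sum, mul_sum]
    _ ≤ 2 * (K * M * ∑ p ∈ T, a p ^ 2) + 2 * (K * M * ∑ p ∈ T, a' p ^ 2) := by linarith
    _ = 2 * K * M * (∑ p ∈ T, a p ^ 2 + ∑ p ∈ T, a' p ^ 2) := by ring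

/-- The ℓ²-norm form: `√(Σ_b (Σ_σ a∘f)²) ≤ √(K·M)·√(Σ_T a²)`. [cite: Balaban1985RegularSpaces, (1.29) p.81] -/
theorem sqrt_sum_sq_sum_comp_le [DecidableEq π] (B : Finset ι) (S : ι → Finset σ) (f : ι → σ → π) (a : π → ℝ)
    {K : ℕ} (hK : ∀ b ∈ B, #(S b) ≤ K) {M : ℕ} (hM : ∀ p, #{x ∈ B.sigma fun b => S b | f x.1 x.2 = p} ≤ M)
    {T : Finset π} (hT : ∀ b ∈ B, ∀ s ∈ S b, f b s ∈ T) :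
    √(∑ b ∈ B, (∑ s ∈ S b, a (f b s)) ^ 2) ≤ √((K : ℝ) * M) * √(∑ p ∈ T, a p ^ 2) := by
  rw [← Real.sqrt_mul (by positivity)]
  exact Real.sqrt_le_sqrt (by simpa [mul_assoc] using sum_sq_sum_comp_le B S f a hK hM hT)

end Summit.QuantumFields.YangMills.Theorems.FluctuationComparisonRegPrIntLS2BetaSlotDoubleCounting
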